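import Literature.Combinatorics.SetFamily.SpreadLemma
import Mathlib.Order.Preorder.Finite
import Mathlib.Data.Fin.Tuple.Basic
import Mathlib.Algebra.BigOperators.Fin
import Mathlib.Algebra.BigOperators.Field
import Mathlib.Tactic.Positivity
import Mathlib.Tactic.Ring
import Mathlib.Tactic.FieldSimp
import HarnessLib

/-!
# Relative homogeneity and the Kupavskii–Zakharov spread approximation lemma

Source: A. Kupavskii, D. Zakharov, *Spread approximations for forbidden intersections problems*,
Adv. Math. 445 (2024) 109653 = arXiv:2203.13379 [KupavskiiZakharov2022]: §2 (relative
`τ`-homogeneity and Observation 8) and §3.1 (the spread approximation procedure, Lemma 11).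

Notation. For a family `𝒜` of finite sets and a set `S`, KZ write `𝒜(S)` for the members of `𝒜`
containing `S` (as a *link*, i.e. with `S` deleted from each member). Only the cardinalities
`|𝒜(S)|` and the iterated restrictions `𝒜(S)(S') = 𝒜(S ∪ S')` enter the statements below, so we
keep the members whole: `supersets 𝒜 S = {A ∈ 𝒜 : S ⊆ A}` (the same `Finset.filter` as in the
tree's `IsSpread`). A subfamily `ℱ ⊆ 𝒜` is `(𝒜, τ)`-*homogeneous* if
`|ℱ(S)| / |ℱ| ≤ τ^{|S|} · |𝒜(S)| / |𝒜|` for every set `S` (KZ §2, the definition preceding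
Observation 8). We state it division-free (`IsRelHomogeneous`); for nonempty `𝒜, ℱ` this is
literally the printed ratio inequality (`isRelHomogeneous_iff`).

Main results (everything is proved):
* `isRelHomogeneous_supersets_of_maximal` — KZ Observation 8: if `X` is inclusion-maximal with
  `|ℱ(X)| ≥ τ^{|X|} (|𝒜(X)| / |𝒜|) |ℱ|`, then `ℱ(X)` is `(𝒜(X), τ)`-homogeneous.
* `IsRelHomogeneous.isSpread` — an `(𝒜, τ)`-homogeneous subfamily of an `r`-spread family `𝒜` is
  `r/τ`-spread (the step "`𝒢'_ℓ` is `r`-spread" in the proof of KZ Theorem 12); this links the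
  notion to `Literature.Combinatorics.SetFamily.IsSpread`.
* `SpreadApproximation 𝒜 ℱ τ q` and `exists_spreadApproximation` — KZ Lemma 11 (spread
  approximation): every `ℱ ⊆ 𝒜` decomposes as `ℱ = ℱ' ⊔ ⨆_i ℱ_i` with sets `S_i`, `|S_i| ≤ q`,
  `ℱ_i ⊆ ℱ(S_i)`, each `ℱ_i` being `(𝒜(S_i), τ)`-homogeneous, and `|ℱ'| ≤ τ^{-(q+1)} |𝒜|`.

Design choices / deviation from print (declared). KZ run the greedy procedure — `S_i` an
inclusion-maximal set with `|ℱ^i(S_i)| ≥ τ^{|S_i|} (|𝒜(S_i)|/|𝒜|) |ℱ^i|`, `ℱ_i := ℱ^i(S_i)`,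
`ℱ^{i+1} := ℱ^i ∖ ℱ_i` — until `|S_i| > q` or `ℱ^i = ∅`. (a) We make explicit that the
maximality search ranges over sets `S` with `ℱ^i(S) ≠ ∅` (implicit in print, where the final
estimate divides by `|𝒜(S_m)|`; for a set contained in no member of `ℱ^i` the density inequality
reads `0 ≥ 0`). (b) We ALSO stop as soon as `|ℱ^i| · τ^{q+1} ≤ |𝒜|`, at which point conclusion
(iii) already holds for the remainder `ℱ' := ℱ^i`. Rule (b) is the variant used by the `PneNP`
matching-polytope programme (cell pnp-psdrank, N2-SpreadStructure §SNT (2), STEP 1, "modified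
stopping rule"); it gives the additional accounting `|𝒜(S_i)| ≤ τ^{q+1} |ℱ_i|` for every piece,
hence `Σ_i |𝒜(S_i)| ≤ τ^{q+1} |ℱ|` (`SpreadApproximation.sum_card_supersets_le`), while the printed
conclusions (i)–(iii) of Lemma 11 hold verbatim (`exists_core_subset`, `homogeneous`,
`card_remainder_le`). The pieces are pairwise disjoint and nonempty by construction; we record
this too, since consumers sum over them.

Links (appended). KZ's `ℱ(S)` is literally the LINK `{A ∖ S : A ∈ ℱ, S ⊆ A}` (§2, p. 6); the
statements above only need its cardinality, but a consumer that passes to the REDUCED ground set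
(the `PneNP` matching programme deletes the support of the core `S_i` and works with the perfect
matchings of the remaining vertices) needs the link proper: `link ℱ S`, `card_link`, its stars
(`supersets_link_of_disjoint` / `_of_not_disjoint`), the LINK FORM of Lemma 11 (ii) —
`IsRelHomogeneous.link`: if every member of `ℱ` contains `S` and `ℱ` is `(𝒜(S), τ)`-homogeneous
then `link ℱ S` is `(link 𝒜 S, τ)`-homogeneous (`τ ≥ 0`; sets meeting `S` contribute `0 ≤ 0`),
`SpreadApproximation.link_homogeneous` — and the invariance of relative homogeneity under
relabelling the ground set by a map injective on a set containing all members
(`IsRelHomogeneous.image_image`).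

Not here: the `t`-intersecting upgrade of the approximation (KZ Theorems 9 and 12, which combine
Lemma 11 with the spread lemma `Literature.Combinatorics.SetFamily.spread_lemma`), the
uniform-family specialisations (Observations 6–7) and §§4–5 of the paper.
-/

namespace Literature.Combinatorics.SetFamily

open Finset

variable {α : Type*} [DecidableEq α]

/-! ### Members containing a given set -/

/-- `supersets 𝒜 S = 𝒜(S)`: the members of the family `𝒜` that contain the set `S`
(Kupavskii–Zakharov write `𝒜(S)`, formally as the link `{A ∖ S : A ∈ 𝒜, S ⊆ A}`; we keep the
members whole, which does not change any cardinality).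
[cite: KupavskiiZakharov2022, §2 (notation ℱ(S)) and §3.1] -/
def supersets (𝒜 : Finset (Finset α)) (S : Finset α) : Finset (Finset α) :=
  𝒜.filter fun A => S ⊆ A

/-- Membership in `𝒜(S)`. [cite: KupavskiiZakharov2022, §2] -/
@[simp] theorem mem_supersets {𝒜 : Finset (Finset α)} {S A : Finset α} :
    A ∈ supersets 𝒜 S ↔ A ∈ 𝒜 ∧ S ⊆ A := mem_filter

/-- `𝒜(S) ⊆ 𝒜`. [cite: KupavskiiZakharov2022, §2] -/
theorem supersets_subset (𝒜 : Finset (Finset α)) (S : Finset α) : supersets 𝒜 S ⊆ 𝒜 :=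
  filter_subset _ _

/-- `𝒜(∅) = 𝒜`. [cite: KupavskiiZakharov2022, §2] -/
@[simp] theorem supersets_emptyset (𝒜 : Finset (Finset α)) : supersets 𝒜 ∅ = 𝒜 :=
  filter_true_of_mem fun _ _ => empty_subset _

/-- `∅(S) = ∅`. [cite: KupavskiiZakharov2022, §2] -/
@[simp] theorem supersets_emptyFamily (S : Finset α) :
    supersets (∅ : Finset (Finset α)) S = ∅ :=
  filter_empty _

/-- `𝒜(S)` is monotone in the family. [cite: KupavskiiZakharov2022, §2] -/
theorem supersets_mono {𝒜 ℬ : Finset (Finset α)} (h : 𝒜 ⊆ ℬ) (S : Finset α) :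
    supersets 𝒜 S ⊆ supersets ℬ S :=
  filter_subset_filter _ h

/-- `𝒜(S)` is antitone in the set: `S ⊆ T → 𝒜(T) ⊆ 𝒜(S)`. [cite: KupavskiiZakharov2022, §2] -/
theorem supersets_anti (𝒜 : Finset (Finset α)) {S T : Finset α} (h : S ⊆ T) :
    supersets 𝒜 T ⊆ supersets 𝒜 S := by
  intro A hA
  rw [mem_supersets] at hA ⊢
  exact ⟨hA.1, h.trans hA.2⟩

/-- Iterated restriction: `𝒜(S)(T) = 𝒜(S ∪ T)` (KZ: "`𝒜(𝒮 ∪ 𝒮') = 𝒜(𝒮) ∪ 𝒜(𝒮')`" is the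
family version; this is the one-set version used throughout §3.1).
[cite: KupavskiiZakharov2022, §3.1] -/
@[simp] theorem supersets_supersets (𝒜 : Finset (Finset α)) (S T : Finset α) :
    supersets (supersets 𝒜 S) T = supersets 𝒜 (S ∪ T) := by
  ext A
  simp only [mem_supersets, union_subset_iff, and_assoc]

/-- If some member of `ℱ` contains `S` then `S ⊆ ⋃ ℱ`. [cite: KupavskiiZakharov2022, §3.1] -/
theorem subset_sup_of_supersets_nonempty {ℱ : Finset (Finset α)} {S : Finset α}
    (h : (supersets ℱ S).Nonempty) : S ⊆ ℱ.sup id := by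
  obtain ⟨A, hA⟩ := h
  rw [mem_supersets] at hA
  exact hA.2.trans (le_sup (f := id) hA.1)

/-! ### Relative homogeneity (KZ §2) -/

/-- **Relative `τ`-homogeneity** (Kupavskii–Zakharov): a subfamily `ℱ ⊆ 𝒜` is
`(𝒜, τ)`-homogeneous ("`τ`-homogeneous relative to `𝒜`") if for every set `S`,
`|ℱ(S)| / |ℱ| ≤ τ^{|S|} · |𝒜(S)| / |𝒜|`. Stated division-free:
`|ℱ(S)| · |𝒜| ≤ τ^{|S|} · |𝒜(S)| · |ℱ|` for all `S`; see `isRelHomogeneous_iff` for the printed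
ratio form when `𝒜, ℱ ≠ ∅`.
[cite: KupavskiiZakharov2022, §2 (definition of (𝒜, τ)-homogeneous, before Observation 8)] -/
def IsRelHomogeneous (τ : ℝ) (𝒜 ℱ : Finset (Finset α)) : Prop :=
  ∀ S : Finset α, (#(supersets ℱ S) : ℝ) * #𝒜 ≤ τ ^ #S * #(supersets 𝒜 S) * #ℱ

/-- The division-free definition agrees with the printed ratio inequality for nonempty families.
[cite: KupavskiiZakharov2022, §2 (definition of (𝒜, τ)-homogeneous)] -/
theorem isRelHomogeneous_iff {τ : ℝ} {𝒜 ℱ : Finset (Finset α)} (h𝒜 : 𝒜.Nonempty)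
    (hℱ : ℱ.Nonempty) :
    IsRelHomogeneous τ 𝒜 ℱ ↔
      ∀ S : Finset α, (#(supersets ℱ S) : ℝ) / #ℱ ≤ τ ^ #S * (#(supersets 𝒜 S) / #𝒜) := by
  have hA : (0 : ℝ) < #𝒜 := by exact_mod_cast h𝒜.card_pos
  have hF : (0 : ℝ) < #ℱ := by exact_mod_cast hℱ.card_pos
  refine forall_congr' fun S => ?_
  rw [div_le_iff₀ hF, show τ ^ #S * (#(supersets 𝒜 S) / #𝒜) * #ℱ
      = τ ^ #S * #(supersets 𝒜 S) * #ℱ / #𝒜 by ring, le_div_iff₀ hA]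

/-- The empty family is homogeneous relative to anything. [cite: KupavskiiZakharov2022, §2] -/
theorem isRelHomogeneous_empty (τ : ℝ) (𝒜 : Finset (Finset α)) :
    IsRelHomogeneous τ 𝒜 ∅ := by
  intro S
  simp only [supersets_emptyFamily, card_empty, Nat.cast_zero, zero_mul, mul_zero, le_refl]

/-- `𝒜` is `(𝒜, τ)`-homogeneous for every `τ ≥ 1`. [cite: KupavskiiZakharov2022, §2] -/
theorem isRelHomogeneous_self {τ : ℝ} (hτ : 1 ≤ τ) (𝒜 : Finset (Finset α)) :
    IsRelHomogeneous τ 𝒜 𝒜 := by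
  intro S
  calc (#(supersets 𝒜 S) : ℝ) * #𝒜 = 1 * #(supersets 𝒜 S) * #𝒜 := by ring
    _ ≤ τ ^ #S * #(supersets 𝒜 S) * #𝒜 :=
      mul_le_mul_of_nonneg_right
        (mul_le_mul_of_nonneg_right (one_le_pow₀ hτ) (Nat.cast_nonneg _)) (Nat.cast_nonneg _)

/-- Monotonicity in the parameter: `(𝒜, τ)`-homogeneous implies `(𝒜, τ')`-homogeneous for
`0 ≤ τ ≤ τ'`. [cite: KupavskiiZakharov2022, §2] -/
theorem IsRelHomogeneous.mono {τ τ' : ℝ} (hτ : 0 ≤ τ) (hle : τ ≤ τ') {𝒜 ℱ : Finset (Finset α)}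
    (h : IsRelHomogeneous τ 𝒜 ℱ) : IsRelHomogeneous τ' 𝒜 ℱ := fun S =>
  (h S).trans <|
    mul_le_mul_of_nonneg_right
      (mul_le_mul_of_nonneg_right (pow_le_pow_left₀ hτ hle _) (Nat.cast_nonneg _))
      (Nat.cast_nonneg _)

/-- The printed consequence of homogeneity for a nonempty ambient family:
`|ℱ(S)| ≤ τ^{|S|} (|𝒜(S)| / |𝒜|) |ℱ|`. [cite: KupavskiiZakharov2022, §2] -/
theorem IsRelHomogeneous.card_supersets_le {τ : ℝ} {𝒜 ℱ : Finset (Finset α)}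
    (h : IsRelHomogeneous τ 𝒜 ℱ) (h𝒜 : 𝒜.Nonempty) (S : Finset α) :
    (#(supersets ℱ S) : ℝ) ≤ τ ^ #S * (#(supersets 𝒜 S) / #𝒜) * #ℱ := by
  have hA : (0 : ℝ) < #𝒜 := by exact_mod_cast h𝒜.card_pos
  rw [show τ ^ #S * (#(supersets 𝒜 S) / #𝒜) * #ℱ = τ ^ #S * #(supersets 𝒜 S) * #ℱ / #𝒜 by ring,
    le_div_iff₀ hA]
  exact h S

/-- **Homogeneous subfamilies of spread families are spread**: if `ℱ ⊆ 𝒜` is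
`(𝒜, τ)`-homogeneous and `𝒜` is `r`-spread then `ℱ` is `r/τ`-spread (the estimate
"`|𝒢'_ℓ(Y)|/|𝒢'_ℓ| ≤ (2τ)^{|Y|} |𝒜(S_ℓ ∪ Y)|/|𝒜(S_ℓ)| < …`, thus `𝒢'_ℓ` is `r`-spread" in the
proof of KZ Theorem 12, in the tree's `IsSpread` currency).
[cite: KupavskiiZakharov2022, Theorem 12 (proof)] -/
theorem IsRelHomogeneous.isSpread {τ r : ℝ} (hτ : 0 < τ) {𝒜 ℱ : Finset (Finset α)}
    (h : IsRelHomogeneous τ 𝒜 ℱ) (hℱ : ℱ ⊆ 𝒜) (hsp : IsSpread r 𝒜) : IsSpread (r / τ) ℱ := by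
  intro Z
  change (#(supersets ℱ Z) : ℝ) ≤ #ℱ / (r / τ) ^ #Z
  have hspZ : (#(supersets 𝒜 Z) : ℝ) ≤ #𝒜 / r ^ #Z := hsp Z
  rcases 𝒜.eq_empty_or_nonempty with h0 | h𝒜
  · subst h0
    obtain rfl : ℱ = ∅ := subset_empty.1 hℱ
    simp
  have hA : (0 : ℝ) < #𝒜 := by exact_mod_cast h𝒜.card_pos
  by_cases hr : r ^ #Z = 0
  · -- then `𝒜(Z) = ∅`, hence `ℱ(Z) = ∅`
    rw [hr, div_zero] at hspZ
    have h0 : supersets 𝒜 Z = ∅ := by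
      rw [← card_eq_zero]; exact_mod_cast le_antisymm hspZ (Nat.cast_nonneg _)
    have h1 : supersets ℱ Z = ∅ := subset_empty.1 (h0 ▸ supersets_mono hℱ Z)
    rw [h1, card_empty, Nat.cast_zero, div_pow, hr, zero_div, div_zero]
  have h1 : (#(supersets ℱ Z) : ℝ) * #𝒜 ≤ τ ^ #Z * (#𝒜 / r ^ #Z) * #ℱ :=
    (h Z).trans
      (mul_le_mul_of_nonneg_right (mul_le_mul_of_nonneg_left hspZ (pow_nonneg hτ.le _))
        (Nat.cast_nonneg _))
  calc (#(supersets ℱ Z) : ℝ) ≤ τ ^ #Z * (#𝒜 / r ^ #Z) * #ℱ / #𝒜 := by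
        rw [le_div_iff₀ hA]; exact h1
    _ = #ℱ / (r / τ) ^ #Z := by
        rw [div_pow]
        field_simp

/-! ### KZ Observation 8: the maximal dense set gives a homogeneous piece -/

/-- **KZ Observation 8.** Let `ℱ ⊆ 𝒜`, `τ ≥ 1`, and let `X` be a set satisfying the density
inequality `|ℱ(X)| ≥ τ^{|X|} (|𝒜(X)|/|𝒜|) |ℱ|` which is inclusion-maximal with this property
among the sets contained in some member of `ℱ`. Then `ℱ(X)` is `(𝒜(X), τ)`-homogeneous.
(Printed proof: for `B ⊋ X`, `|ℱ(B)| ≤ τ^{|B|} (|𝒜(B)|/|𝒜|) |ℱ| ≤ τ^{|B|-|X|} (|𝒜(B)|/|𝒜(X)|)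
|ℱ(X)|`; here with `B = X ∪ S` and `|B| - |X| ≤ |S|`.)
[cite: KupavskiiZakharov2022, Observation 8] -/
theorem isRelHomogeneous_supersets_of_maximal {τ : ℝ} (hτ : 1 ≤ τ) {𝒜 ℱ : Finset (Finset α)}
    (hℱ : ℱ ⊆ 𝒜) {X : Finset α}
    (hX : τ ^ #X * #(supersets 𝒜 X) * #ℱ ≤ (#(supersets ℱ X) : ℝ) * #𝒜)
    (hmax : ∀ B : Finset α, X ⊂ B → (supersets ℱ B).Nonempty →
      (#(supersets ℱ B) : ℝ) * #𝒜 < τ ^ #B * #(supersets 𝒜 B) * #ℱ) :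
    IsRelHomogeneous τ (supersets 𝒜 X) (supersets ℱ X) := by
  have hτ0 : 0 ≤ τ := zero_le_one.trans hτ
  intro S
  rw [supersets_supersets, supersets_supersets]
  by_cases hSX : S ⊆ X
  · rw [union_eq_left.2 hSX]
    calc (#(supersets ℱ X) : ℝ) * #(supersets 𝒜 X)
          = 1 * #(supersets 𝒜 X) * #(supersets ℱ X) := by ring
      _ ≤ τ ^ #S * #(supersets 𝒜 X) * #(supersets ℱ X) :=
        mul_le_mul_of_nonneg_right
          (mul_le_mul_of_nonneg_right (one_le_pow₀ hτ) (Nat.cast_nonneg _)) (Nat.cast_nonneg _)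
  have hXB : X ⊂ X ∪ S :=
    Finset.ssubset_iff_subset_ne.2
      ⟨subset_union_left, fun h => hSX (by rw [h]; exact subset_union_right)⟩
  rcases (supersets ℱ (X ∪ S)).eq_empty_or_nonempty with hB0 | hBne
  · rw [hB0, card_empty, Nat.cast_zero, zero_mul]
    exact mul_nonneg (mul_nonneg (pow_nonneg hτ0 _) (Nat.cast_nonneg _)) (Nat.cast_nonneg _)
  have h1 := (hmax _ hXB hBne).le
  have hℱpos : (0 : ℝ) < #ℱ := by
    exact_mod_cast (hBne.mono (supersets_subset _ _)).card_pos
  have h𝒜pos : (0 : ℝ) < #𝒜 := by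
    exact_mod_cast (hBne.mono ((supersets_subset _ _).trans hℱ)).card_pos
  have hτX : (0 : ℝ) < τ ^ #X := pow_pos (zero_lt_one.trans_le hτ) _
  have h3 : τ ^ #(X ∪ S) ≤ τ ^ #X * τ ^ #S := by
    rw [← pow_add]; exact pow_le_pow_right₀ hτ (card_union_le X S)
  refine le_of_mul_le_mul_right ?_ (mul_pos (mul_pos h𝒜pos hℱpos) hτX)
  calc (#(supersets ℱ (X ∪ S)) : ℝ) * #(supersets 𝒜 X) * (#𝒜 * #ℱ * τ ^ #X)
        = (#(supersets ℱ (X ∪ S)) * #𝒜) * (τ ^ #X * #(supersets 𝒜 X) * #ℱ) := by ring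
    _ ≤ (τ ^ #(X ∪ S) * #(supersets 𝒜 (X ∪ S)) * #ℱ) * (#(supersets ℱ X) * #𝒜) :=
        mul_le_mul h1 hX (mul_nonneg (mul_nonneg hτX.le (Nat.cast_nonneg _)) (Nat.cast_nonneg _))
          (mul_nonneg (mul_nonneg (pow_nonneg hτ0 _) (Nat.cast_nonneg _)) (Nat.cast_nonneg _))
    _ = τ ^ #(X ∪ S) * (#(supersets 𝒜 (X ∪ S)) * #ℱ * #(supersets ℱ X) * #𝒜) := by ring
    _ ≤ (τ ^ #X * τ ^ #S) * (#(supersets 𝒜 (X ∪ S)) * #ℱ * #(supersets ℱ X) * #𝒜) :=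
        mul_le_mul_of_nonneg_right h3 (by positivity)
    _ = τ ^ #S * #(supersets 𝒜 (X ∪ S)) * #(supersets ℱ X) * (#𝒜 * #ℱ * τ ^ #X) := by ring

/-- **The greedy step of KZ §3.1.** For a nonempty family `ℱ` there is a set `X`, contained in
some member of `ℱ`, which satisfies the density inequality
`|ℱ(X)| ≥ τ^{|X|} (|𝒜(X)|/|𝒜|) |ℱ|` and is inclusion-maximal with this property among sets
contained in a member of `ℱ` ("find an inclusion-maximal set `S_i` such that
`|ℱ^i(S_i)| ≥ τ^{|S_i|} (|𝒜(S_i)|/|𝒜|) |ℱ^i|`"; `S = ∅` always qualifies).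
[cite: KupavskiiZakharov2022, §3.1 (procedure after Lemma 11)] -/
theorem exists_maximal_dense (τ : ℝ) (𝒜 : Finset (Finset α)) {ℱ : Finset (Finset α)}
    (hℱ : ℱ.Nonempty) :
    ∃ X : Finset α, ((supersets ℱ X).Nonempty ∧
        τ ^ #X * #(supersets 𝒜 X) * #ℱ ≤ (#(supersets ℱ X) : ℝ) * #𝒜) ∧
      ∀ B : Finset α, X ⊂ B → (supersets ℱ B).Nonempty →
        (#(supersets ℱ B) : ℝ) * #𝒜 < τ ^ #B * #(supersets 𝒜 B) * #ℱ := by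
  classical
  let Q : Finset (Finset α) := (ℱ.sup id).powerset.filter fun X =>
    (supersets ℱ X).Nonempty ∧ τ ^ #X * #(supersets 𝒜 X) * #ℱ ≤ (#(supersets ℱ X) : ℝ) * #𝒜
  have h0 : ∅ ∈ Q := by
    refine mem_filter.2 ⟨empty_mem_powerset _, ?_, ?_⟩
    · rwa [supersets_emptyset]
    · rw [supersets_emptyset, supersets_emptyset, card_empty, pow_zero, one_mul, mul_comm]
  obtain ⟨X, hX⟩ := Q.exists_maximal ⟨∅, h0⟩
  refine ⟨X, (mem_filter.1 hX.1).2, fun B hXB hBne => ?_⟩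
  by_contra hlt
  have hBQ : B ∈ Q :=
    mem_filter.2 ⟨mem_powerset.2 (subset_sup_of_supersets_nonempty hBne), hBne, not_lt.1 hlt⟩
  exact hXB.2 (hX.2 hBQ hXB.1)

/-! ### KZ Lemma 11: spread approximations -/

/-- A **spread approximation** of `ℱ ⊆ 𝒜` with parameters `τ, q` (Kupavskii–Zakharov,
Lemma 11, with the accounting of the modified stopping rule): finitely many pieces
`ℱ_i = piece i ⊆ ℱ(S_i)` with cores `S_i = core i` of size `≤ q`, pairwise disjoint and nonempty,
each `ℱ_i` being `(𝒜(S_i), τ)`-homogeneous (KZ (ii)); the remainder `ℱ' = ℱ ∖ ⋃_i ℱ_i`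
(so `ℱ ∖ ℱ' ⊆ 𝒜(𝒮)`, KZ (i)) has `|ℱ'| · τ^{q+1} ≤ |𝒜|` (KZ (iii)); and each piece pays for
its core: `|𝒜(S_i)| ≤ τ^{q+1} |ℱ_i|`.
[cite: KupavskiiZakharov2022, Lemma 11] -/
structure SpreadApproximation (𝒜 ℱ : Finset (Finset α)) (τ : ℝ) (q : ℕ) where
  /-- the number of pieces -/
  k : ℕ
  /-- the cores `S_i` (the "spread approximation" family `𝒮 = {S_i}`) -/
  core : Fin k → Finset α
  /-- the pieces `ℱ_i` -/
  piece : Fin k → Finset (Finset α)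
  /-- `|S_i| ≤ q` -/
  card_core_le : ∀ i, #(core i) ≤ q
  /-- every piece is nonempty -/
  piece_nonempty : ∀ i, (piece i).Nonempty
  /-- `ℱ_i ⊆ ℱ(S_i)` -/
  piece_subset : ∀ i, piece i ⊆ supersets ℱ (core i)
  /-- the pieces are pairwise disjoint -/
  disjoint : ∀ i j, i ≠ j → Disjoint (piece i) (piece j)
  /-- KZ (ii): `ℱ_i` is `(𝒜(S_i), τ)`-homogeneous -/
  homogeneous : ∀ i, IsRelHomogeneous τ (supersets 𝒜 (core i)) (piece i)
  /-- KZ (iii): the remainder `ℱ' = ℱ ∖ ⋃_i ℱ_i` has `|ℱ'| τ^{q+1} ≤ |𝒜|` -/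
  card_remainder_le : (#(ℱ \ univ.biUnion piece) : ℝ) * τ ^ (q + 1) ≤ #𝒜
  /-- accounting of the modified stopping rule: `|𝒜(S_i)| ≤ τ^{q+1} |ℱ_i|` -/
  card_supersets_le : ∀ i, (#(supersets 𝒜 (core i)) : ℝ) ≤ τ ^ (q + 1) * #(piece i)

namespace SpreadApproximation

variable {𝒜 ℱ : Finset (Finset α)} {τ : ℝ} {q : ℕ}

/-- The remainder `ℱ' = ℱ ∖ ⋃_i ℱ_i`. [cite: KupavskiiZakharov2022, Lemma 11] -/
def remainder (D : SpreadApproximation 𝒜 ℱ τ q) : Finset (Finset α) :=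
  ℱ \ univ.biUnion D.piece

/-- Membership in the remainder. [cite: KupavskiiZakharov2022, Lemma 11] -/
theorem mem_remainder (D : SpreadApproximation 𝒜 ℱ τ q) {A : Finset α} :
    A ∈ D.remainder ↔ A ∈ ℱ ∧ ∀ i, A ∉ D.piece i := by
  simp only [remainder, mem_sdiff, mem_biUnion, mem_univ, true_and, not_exists]

/-- `ℱ' ⊆ ℱ`. [cite: KupavskiiZakharov2022, Lemma 11] -/
theorem remainder_subset (D : SpreadApproximation 𝒜 ℱ τ q) : D.remainder ⊆ ℱ := sdiff_subset

/-- `ℱ_i ⊆ ℱ`. [cite: KupavskiiZakharov2022, Lemma 11] -/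
theorem piece_subset_family (D : SpreadApproximation 𝒜 ℱ τ q) (i : Fin D.k) : D.piece i ⊆ ℱ :=
  (D.piece_subset i).trans (supersets_subset _ _)

/-- Members of `ℱ_i` contain the core `S_i`. [cite: KupavskiiZakharov2022, Lemma 11] -/
theorem core_subset_of_mem_piece (D : SpreadApproximation 𝒜 ℱ τ q) {i : Fin D.k}
    {A : Finset α} (h : A ∈ D.piece i) : D.core i ⊆ A :=
  (mem_supersets.1 (D.piece_subset i h)).2

/-- `ℱ_i ⊆ 𝒜(S_i)` when `ℱ ⊆ 𝒜`. [cite: KupavskiiZakharov2022, Lemma 11] -/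
theorem piece_subset_supersets (D : SpreadApproximation 𝒜 ℱ τ q) (hℱ : ℱ ⊆ 𝒜) (i : Fin D.k) :
    D.piece i ⊆ supersets 𝒜 (D.core i) :=
  (D.piece_subset i).trans (supersets_mono hℱ _)

/-- `⋃_i ℱ_i ⊆ ℱ`. [cite: KupavskiiZakharov2022, Lemma 11] -/
theorem biUnion_piece_subset (D : SpreadApproximation 𝒜 ℱ τ q) : univ.biUnion D.piece ⊆ ℱ :=
  biUnion_subset.2 fun i _ => D.piece_subset_family i

/-- The decomposition `ℱ = ℱ' ∪ ⋃_i ℱ_i`. [cite: KupavskiiZakharov2022, Lemma 11] -/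
theorem remainder_union_biUnion (D : SpreadApproximation 𝒜 ℱ τ q) :
    D.remainder ∪ univ.biUnion D.piece = ℱ :=
  sdiff_union_of_subset D.biUnion_piece_subset

/-- `ℱ'` is disjoint from every piece. [cite: KupavskiiZakharov2022, Lemma 11] -/
theorem disjoint_remainder_piece (D : SpreadApproximation 𝒜 ℱ τ q) (i : Fin D.k) :
    Disjoint D.remainder (D.piece i) :=
  disjoint_sdiff_self_left.mono_right (subset_biUnion_of_mem D.piece (mem_univ i))

/-- **KZ Lemma 11 (i)**: `ℱ ∖ ℱ' ⊆ 𝒜(𝒮)` — every member of `ℱ` outside the remainder lies in a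
piece and hence contains a core. [cite: KupavskiiZakharov2022, Lemma 11 (i)] -/
theorem exists_core_subset (D : SpreadApproximation 𝒜 ℱ τ q) {A : Finset α} (hA : A ∈ ℱ)
    (hA' : A ∉ D.remainder) : ∃ i, A ∈ D.piece i ∧ D.core i ⊆ A := by
  rw [mem_remainder, not_and, not_forall] at hA'
  obtain ⟨i, hi⟩ := hA' hA
  rw [not_not] at hi
  exact ⟨i, hi, D.core_subset_of_mem_piece hi⟩

/-- `|⋃_i ℱ_i| = Σ_i |ℱ_i|` (the pieces are disjoint). [cite: KupavskiiZakharov2022, Lemma 11] -/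
theorem card_biUnion_piece (D : SpreadApproximation 𝒜 ℱ τ q) :
    #(univ.biUnion D.piece) = ∑ i, #(D.piece i) :=
  card_biUnion fun i _ j _ hij => D.disjoint i j hij

/-- `Σ_i |ℱ_i| ≤ |ℱ|`. [cite: KupavskiiZakharov2022, Lemma 11] -/
theorem sum_card_piece_le (D : SpreadApproximation 𝒜 ℱ τ q) : ∑ i, #(D.piece i) ≤ #ℱ := by
  rw [← card_biUnion_piece]
  exact card_le_card D.biUnion_piece_subset

/-- `|ℱ'| + Σ_i |ℱ_i| = |ℱ|`. [cite: KupavskiiZakharov2022, Lemma 11] -/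
theorem card_remainder_add_sum (D : SpreadApproximation 𝒜 ℱ τ q) :
    #D.remainder + ∑ i, #(D.piece i) = #ℱ := by
  rw [← card_biUnion_piece, remainder, card_sdiff_add_card_eq_card D.biUnion_piece_subset]

/-- **KZ Lemma 11 (iii)** in the printed form `|ℱ'| ≤ τ^{-q-1} |𝒜|`.
[cite: KupavskiiZakharov2022, Lemma 11 (iii)] -/
theorem card_remainder_le' (D : SpreadApproximation 𝒜 ℱ τ q) (hτ : 0 < τ) :
    (#D.remainder : ℝ) ≤ #𝒜 / τ ^ (q + 1) := by
  rw [le_div_iff₀ (pow_pos hτ _)]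
  exact D.card_remainder_le

/-- The accounting of the modified stopping rule, summed: `Σ_i |𝒜(S_i)| ≤ τ^{q+1} |ℱ|`
(pnp-psdrank N2-SpreadStructure §SNT (2) STEP 1: `Σ_i ν(⟨S_i⟩) ≤ τ^{q+1} Σ_i ν(ℱ_i) ≤ K`).
[cite: KupavskiiZakharov2022, Lemma 11 (procedure)] -/
theorem sum_card_supersets_le (D : SpreadApproximation 𝒜 ℱ τ q) (hτ : 0 ≤ τ) :
    ∑ i, (#(supersets 𝒜 (D.core i)) : ℝ) ≤ τ ^ (q + 1) * #ℱ := by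
  calc ∑ i, (#(supersets 𝒜 (D.core i)) : ℝ) ≤ ∑ i, τ ^ (q + 1) * (#(D.piece i) : ℝ) :=
        sum_le_sum fun i _ => D.card_supersets_le i
    _ = τ ^ (q + 1) * ((∑ i, #(D.piece i) : ℕ) : ℝ) := by rw [← mul_sum, Nat.cast_sum]
    _ ≤ τ ^ (q + 1) * #ℱ :=
        mul_le_mul_of_nonneg_left (by exact_mod_cast D.sum_card_piece_le) (pow_nonneg hτ _)

/-- Normalised forms (`ν = |·|/|𝒜|`, the uniform measure on the ambient family):
`ν(ℱ') ≤ τ^{-(q+1)}`. [cite: KupavskiiZakharov2022, Lemma 11 (iii)] -/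
theorem card_remainder_div_le (D : SpreadApproximation 𝒜 ℱ τ q) (hτ : 0 < τ)
    (h𝒜 : 𝒜.Nonempty) : (#D.remainder : ℝ) / #𝒜 ≤ (τ ^ (q + 1))⁻¹ := by
  have hA : (0 : ℝ) < #𝒜 := by exact_mod_cast h𝒜.card_pos
  rw [div_le_iff₀ hA, inv_mul_eq_div]
  exact D.card_remainder_le' hτ

/-- Normalised form of the accounting: `Σ_i ν(𝒜(S_i)) ≤ τ^{q+1} ν(ℱ)`.
[cite: KupavskiiZakharov2022, Lemma 11 (procedure)] -/
theorem sum_card_supersets_div_le (D : SpreadApproximation 𝒜 ℱ τ q) (hτ : 0 ≤ τ)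
    (h𝒜 : 𝒜.Nonempty) :
    ∑ i, (#(supersets 𝒜 (D.core i)) : ℝ) / #𝒜 ≤ τ ^ (q + 1) * (#ℱ / #𝒜) := by
  have hA : (0 : ℝ) < #𝒜 := by exact_mod_cast h𝒜.card_pos
  rw [← sum_div, div_le_iff₀ hA, mul_assoc, div_mul_cancel₀ _ hA.ne']
  exact D.sum_card_supersets_le hτ

/-- The trivial approximation (no pieces, remainder `ℱ`), admissible when
`|ℱ| τ^{q+1} ≤ |𝒜|` — the stopping case of the procedure.
[cite: KupavskiiZakharov2022, Lemma 11 (procedure, stopping step)] -/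
def nil (h : (#ℱ : ℝ) * τ ^ (q + 1) ≤ #𝒜) : SpreadApproximation 𝒜 ℱ τ q where
  k := 0
  core := fun i => i.elim0
  piece := fun i => i.elim0
  card_core_le := fun i => i.elim0
  piece_nonempty := fun i => i.elim0
  piece_subset := fun i => i.elim0
  disjoint := fun i => i.elim0
  homogeneous := fun i => i.elim0
  card_remainder_le := by simpa using h
  card_supersets_le := fun i => i.elim0

/-- `⋃` over `Fin (k+1)` of a `Fin.cons` tuple. [cite: KupavskiiZakharov2022, Lemma 11] -/
theorem biUnion_univ_cons {β : Type*} [DecidableEq β] {k : ℕ} (P : Finset β)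
    (f : Fin k → Finset β) :
    (univ : Finset (Fin (k + 1))).biUnion (Fin.cons P f : Fin (k + 1) → Finset β)
      = P ∪ univ.biUnion f := by
  ext A
  simp only [mem_biUnion, mem_univ, true_and, mem_union, Fin.exists_fin_succ, Fin.cons_zero,
    Fin.cons_succ]

/-- One step of the procedure: prepend the piece `P = ℱ(X)`-type piece with core `X` to an
approximation of `ℱ ∖ P`. [cite: KupavskiiZakharov2022, Lemma 11 (procedure, iteration step)] -/
def cons (X : Finset α) (P : Finset (Finset α)) (D : SpreadApproximation 𝒜 (ℱ \ P) τ q)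
    (hXq : #X ≤ q) (hPne : P.Nonempty) (hP : P ⊆ supersets ℱ X)
    (hhom : IsRelHomogeneous τ (supersets 𝒜 X) P)
    (hacc : (#(supersets 𝒜 X) : ℝ) ≤ τ ^ (q + 1) * #P) : SpreadApproximation 𝒜 ℱ τ q where
  k := D.k + 1
  core := Fin.cons X D.core
  piece := Fin.cons P D.piece
  card_core_le i := by
    rcases Fin.eq_zero_or_eq_succ i with rfl | ⟨j, rfl⟩
    · simpa using hXq
    · simpa using D.card_core_le j
  piece_nonempty i := by
    rcases Fin.eq_zero_or_eq_succ i with rfl | ⟨j, rfl⟩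
    · simpa using hPne
    · simpa using D.piece_nonempty j
  piece_subset i := by
    rcases Fin.eq_zero_or_eq_succ i with rfl | ⟨j, rfl⟩
    · simpa using hP
    · simpa using (D.piece_subset j).trans (supersets_mono sdiff_subset _)
  disjoint i j hij := by
    rcases Fin.eq_zero_or_eq_succ i with rfl | ⟨i, rfl⟩ <;>
      rcases Fin.eq_zero_or_eq_succ j with rfl | ⟨j, rfl⟩
    · exact absurd rfl hij
    · simpa using disjoint_sdiff.mono_right (D.piece_subset_family j)
    · simpa using (disjoint_sdiff.mono_right (D.piece_subset_family i)).symm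
    · simpa using D.disjoint i j fun h => hij (by rw [h])
  homogeneous i := by
    rcases Fin.eq_zero_or_eq_succ i with rfl | ⟨j, rfl⟩
    · simpa using hhom
    · simpa using D.homogeneous j
  card_remainder_le := by
    have h : ℱ \ (P ∪ univ.biUnion D.piece) = (ℱ \ P) \ univ.biUnion D.piece := by
      ext A
      simp only [mem_sdiff, mem_union, not_or, and_assoc]
    rw [biUnion_univ_cons, h]
    exact D.card_remainder_le
  card_supersets_le i := by
    rcases Fin.eq_zero_or_eq_succ i with rfl | ⟨j, rfl⟩
    · simpa using hacc
    · simpa using D.card_supersets_le j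

end SpreadApproximation

/-- The induction behind KZ Lemma 11 (on the size of `ℱ`). [cite: KupavskiiZakharov2022, Lemma 11] -/
private theorem exists_spreadApproximation_aux {𝒜 : Finset (Finset α)} {τ : ℝ} (hτ : 1 ≤ τ)
    (q : ℕ) : ∀ (n : ℕ) (ℱ : Finset (Finset α)), ℱ ⊆ 𝒜 → #ℱ ≤ n →
      Nonempty (SpreadApproximation 𝒜 ℱ τ q) := by
  have hτ0 : 0 < τ := zero_lt_one.trans_le hτ
  intro n
  induction n with
  | zero =>
    intro ℱ _ hcard
    obtain rfl : ℱ = ∅ := card_eq_zero.1 (Nat.le_zero.1 hcard)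
    exact ⟨SpreadApproximation.nil (by simp)⟩
  | succ n ih =>
    intro ℱ hℱ hcard
    by_cases hsmall : (#ℱ : ℝ) * τ ^ (q + 1) ≤ #𝒜
    · exact ⟨SpreadApproximation.nil hsmall⟩
    have hbig : (#𝒜 : ℝ) < #ℱ * τ ^ (q + 1) := lt_of_not_ge hsmall
    have hℱne : ℱ.Nonempty := by
      rw [nonempty_iff_ne_empty]
      rintro rfl
      rw [card_empty, Nat.cast_zero, zero_mul] at hbig
      exact absurd hbig (not_lt.2 (Nat.cast_nonneg _))
    have hℱpos : (0 : ℝ) < #ℱ := by exact_mod_cast hℱne.card_pos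
    obtain ⟨X, ⟨hXne, hXdense⟩, hXmax⟩ := exists_maximal_dense τ 𝒜 hℱne
    have hhom := isRelHomogeneous_supersets_of_maximal hτ hℱ hXdense hXmax
    have hPpos : (0 : ℝ) < #(supersets ℱ X) := by exact_mod_cast hXne.card_pos
    have hP𝒜 : (#(supersets ℱ X) : ℝ) ≤ #(supersets 𝒜 X) := by
      exact_mod_cast card_le_card (supersets_mono hℱ X)
    have h𝒜Xpos : (0 : ℝ) < #(supersets 𝒜 X) := hPpos.trans_le hP𝒜
    by_cases hXq : q < #X
    · -- stop: `|S| > q`, remainder `ℱ`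
      refine ⟨SpreadApproximation.nil (le_of_mul_le_mul_right ?_ h𝒜Xpos)⟩
      calc (#ℱ : ℝ) * τ ^ (q + 1) * #(supersets 𝒜 X)
            ≤ #ℱ * τ ^ #X * #(supersets 𝒜 X) :=
          mul_le_mul_of_nonneg_right
            (mul_le_mul_of_nonneg_left (pow_le_pow_right₀ hτ hXq) (Nat.cast_nonneg _))
            (Nat.cast_nonneg _)
        _ = τ ^ #X * #(supersets 𝒜 X) * #ℱ := by ring
        _ ≤ #(supersets ℱ X) * #𝒜 := hXdense
        _ ≤ #(supersets 𝒜 X) * #𝒜 := mul_le_mul_of_nonneg_right hP𝒜 (Nat.cast_nonneg _)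
        _ = #𝒜 * #(supersets 𝒜 X) := mul_comm _ _
    · -- iterate on `ℱ ∖ ℱ(X)`
      have hXq : #X ≤ q := not_lt.1 hXq
      have hlt : #(ℱ \ supersets ℱ X) < #ℱ :=
        card_lt_card (sdiff_ssubset (supersets_subset ℱ X) hXne)
      obtain ⟨D⟩ := ih (ℱ \ supersets ℱ X) (sdiff_subset.trans hℱ) (by omega)
      refine ⟨D.cons X (supersets ℱ X) hXq hXne Subset.rfl hhom
        (le_of_mul_le_mul_right ?_ hℱpos)⟩
      calc (#(supersets 𝒜 X) : ℝ) * #ℱ = 1 * #(supersets 𝒜 X) * #ℱ := by ring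
        _ ≤ τ ^ #X * #(supersets 𝒜 X) * #ℱ :=
          mul_le_mul_of_nonneg_right
            (mul_le_mul_of_nonneg_right (one_le_pow₀ hτ) (Nat.cast_nonneg _)) (Nat.cast_nonneg _)
        _ ≤ #(supersets ℱ X) * #𝒜 := hXdense
        _ ≤ #(supersets ℱ X) * (#ℱ * τ ^ (q + 1)) :=
          mul_le_mul_of_nonneg_left hbig.le (Nat.cast_nonneg _)
        _ = τ ^ (q + 1) * #(supersets ℱ X) * #ℱ := by ring

/-- **Kupavskii–Zakharov, Lemma 11 (spread approximation).** Fix an ambient family `𝒜`,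
`τ ≥ 1` and `q`. Every `ℱ ⊆ 𝒜` has a spread approximation: sets `S_1, …, S_k` of size `≤ q`
and pairwise disjoint nonempty pieces `ℱ_i ⊆ ℱ(S_i)` such that (i) `ℱ ∖ ℱ' ⊆ 𝒜(𝒮)` for the
remainder `ℱ' = ℱ ∖ ⋃ ℱ_i`, (ii) each `ℱ_i` is `(𝒜(S_i), τ)`-homogeneous, (iii)
`|ℱ'| ≤ τ^{-q-1} |𝒜|`; moreover `|𝒜(S_i)| ≤ τ^{q+1} |ℱ_i|` for every `i` (modified stopping
rule, see the module docstring). [cite: KupavskiiZakharov2022, Lemma 11] -/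
theorem exists_spreadApproximation {𝒜 ℱ : Finset (Finset α)} (hℱ : ℱ ⊆ 𝒜) {τ : ℝ}
    (hτ : 1 ≤ τ) (q : ℕ) : Nonempty (SpreadApproximation 𝒜 ℱ τ q) :=
  exists_spreadApproximation_aux hτ q _ ℱ hℱ le_rfl

/-- A chosen spread approximation of `ℱ ⊆ 𝒜` (by choice from `exists_spreadApproximation`).
[cite: KupavskiiZakharov2022, Lemma 11] -/
noncomputable def spreadApproximation {𝒜 ℱ : Finset (Finset α)} (hℱ : ℱ ⊆ 𝒜) {τ : ℝ}
    (hτ : 1 ≤ τ) (q : ℕ) : SpreadApproximation 𝒜 ℱ τ q :=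
  Classical.choice (exists_spreadApproximation hℱ hτ q)


/-! ### Homogeneity relative to a star `𝒜(S)` (appended 2026-08-26)

In print `ℱ_B(B)` and `𝒜(B)` are links (members with `B` deleted), so relative homogeneity of a
piece is a condition on sets disjoint from its core only. With members kept whole the same
reduction holds: for a family all of whose members contain `S`, `ℱ(T) = ℱ(T ∖ S)`, and
`(𝒜(S), τ)`-homogeneity need only be checked on sets `T` disjoint from `S`, where it reads
`|ℱ(T)| · |𝒜(S)| ≤ τ^{|T|} · |𝒜(S ∪ T)| · |ℱ|` — the form in which a consumer transports a piece
to the reduced instance on the ground set with `S` (or its support) removed. -/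

/-- If every member of `ℱ` contains `S`, then `ℱ(T) = ℱ(T ∖ S)`.
[cite: KupavskiiZakharov2022, §2 (notation ℱ(S), link form)] -/
theorem supersets_eq_supersets_sdiff {ℱ : Finset (Finset α)} {S : Finset α}
    (hℱ : ∀ A ∈ ℱ, S ⊆ A) (T : Finset α) : supersets ℱ T = supersets ℱ (T \ S) := by
  ext A
  simp only [mem_supersets]
  constructor
  · rintro ⟨hA, hT⟩
    exact ⟨hA, sdiff_subset.trans hT⟩
  · rintro ⟨hA, hT⟩
    refine ⟨hA, fun x hx => ?_⟩
    by_cases hxS : x ∈ S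
    · exact hℱ A hA hxS
    · exact hT (mem_sdiff.2 ⟨hx, hxS⟩)

/-- Members of a subfamily of `𝒜(S)` contain `S`. [cite: KupavskiiZakharov2022, §2] -/
theorem subset_of_mem_of_subset_supersets {𝒜 ℱ : Finset (Finset α)} {S : Finset α}
    (hℱ : ℱ ⊆ supersets 𝒜 S) : ∀ A ∈ ℱ, S ⊆ A := fun _ hA =>
  (mem_supersets.1 (hℱ hA)).2

/-- **Relative homogeneity with respect to a star is a condition on sets disjoint from the core**:
if every member of `ℱ` contains `S` and `τ ≥ 1`, then `ℱ` is `(𝒜(S), τ)`-homogeneous iff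
`|ℱ(T)| · |𝒜(S)| ≤ τ^{|T|} · |𝒜(S ∪ T)| · |ℱ|` for all `T` disjoint from `S` (the link form of
print, KZ Lemma 11 (ii): "`ℱ_B(B)` is `(𝒜(B), τ)`-homogeneous").
[cite: KupavskiiZakharov2022, Lemma 11 (ii) and §2 (definition)] -/
theorem isRelHomogeneous_supersets_iff {τ : ℝ} (hτ : 1 ≤ τ) {𝒜 ℱ : Finset (Finset α)}
    {S : Finset α} (hℱ : ∀ A ∈ ℱ, S ⊆ A) :
    IsRelHomogeneous τ (supersets 𝒜 S) ℱ ↔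
      ∀ T : Finset α, Disjoint S T →
        (#(supersets ℱ T) : ℝ) * #(supersets 𝒜 S) ≤ τ ^ #T * #(supersets 𝒜 (S ∪ T)) * #ℱ := by
  constructor
  · intro h T _
    simpa only [supersets_supersets] using h T
  · intro h T
    rw [supersets_supersets, supersets_eq_supersets_sdiff hℱ T, ← union_sdiff_self_eq_union]
    refine (h (T \ S) disjoint_sdiff).trans ?_
    exact mul_le_mul_of_nonneg_right
      (mul_le_mul_of_nonneg_right (pow_le_pow_right₀ hτ (card_le_card sdiff_subset))
        (Nat.cast_nonneg _)) (Nat.cast_nonneg _)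

/-- The pieces of a spread approximation, in the disjoint-from-the-core form: for `T` disjoint
from `S_i`, `|ℱ_i(T)| · |𝒜(S_i)| ≤ τ^{|T|} · |𝒜(S_i ∪ T)| · |ℱ_i|`.
[cite: KupavskiiZakharov2022, Lemma 11 (ii)] -/
theorem SpreadApproximation.homogeneous_disjoint {𝒜 ℱ : Finset (Finset α)} {τ : ℝ} {q : ℕ}
    (D : SpreadApproximation 𝒜 ℱ τ q) (hτ : 1 ≤ τ) (i : Fin D.k) {T : Finset α}
    (hT : Disjoint (D.core i) T) :
    (#(supersets (D.piece i) T) : ℝ) * #(supersets 𝒜 (D.core i))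
      ≤ τ ^ #T * #(supersets 𝒜 (D.core i ∪ T)) * #(D.piece i) :=
  (isRelHomogeneous_supersets_iff hτ (subset_of_mem_of_subset_supersets (D.piece_subset i))).1
    (D.homogeneous i) T hT

/-! ### Links: KZ's `ℱ(S) = {A ∖ S : A ∈ ℱ, S ⊆ A}` proper; homogeneity of links; relabelling (appended)

Kupavskii–Zakharov's `ℱ(S)` deletes `S` from each member [KupavskiiZakharov2022, §2, p. 6:
`ℱ(S) := {A ∖ S : A ∈ ℱ, S ⊂ A}`]; Lemma 11 (ii) — "`ℱ_B(B)` is `(𝒜(B), τ)`-homogeneous" — is a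
statement about two LINK families on the ground set with `B` removed. `supersets` kept the members
whole (same cardinalities); here is the link itself and the transfer of homogeneity to it, plus
transport of relative homogeneity along a relabelling of the ground set. -/

section Links

variable {𝒜 ℱ : Finset (Finset α)} {S T : Finset α}

/-- **The link** `ℱ(S) := {A ∖ S : A ∈ ℱ, S ⊆ A}` of a family at a set (Kupavskii–Zakharov's
`ℱ(S)` proper, with `S` deleted from each member). [cite: KupavskiiZakharov2022, §2 (p. 6, definition of ℱ(S))] -/
def link (ℱ : Finset (Finset α)) (S : Finset α) : Finset (Finset α) :=
  (supersets ℱ S).image (· \ S)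

/-- Membership in the link. [cite: KupavskiiZakharov2022, §2 (p. 6, definition of ℱ(S))] -/
theorem mem_link {B : Finset α} : B ∈ link ℱ S ↔ ∃ A ∈ ℱ, S ⊆ A ∧ A \ S = B := by
  simp only [link, mem_image, mem_supersets, and_assoc]

/-- `A ∖ S ∈ ℱ(S)` for `A ∈ ℱ`, `S ⊆ A`. [cite: KupavskiiZakharov2022, §2 (p. 6, definition of ℱ(S))] -/
theorem sdiff_mem_link {A : Finset α} (hA : A ∈ ℱ) (hS : S ⊆ A) : A \ S ∈ link ℱ S :=
  mem_link.2 ⟨A, hA, hS, rfl⟩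

/-- Members of the link avoid `S`. [cite: KupavskiiZakharov2022, §2 (p. 6, definition of ℱ(S))] -/
theorem disjoint_of_mem_link {B : Finset α} (hB : B ∈ link ℱ S) : Disjoint S B := by
  obtain ⟨A, -, -, rfl⟩ := mem_link.1 hB
  exact disjoint_sdiff

/-- `S ∪ B ∈ ℱ` for `B ∈ ℱ(S)` (the inverse of `A ↦ A ∖ S`). [cite: KupavskiiZakharov2022, §2 (p. 6, definition of ℱ(S))] -/
theorem union_mem_of_mem_link {B : Finset α} (hB : B ∈ link ℱ S) : S ∪ B ∈ ℱ := by
  obtain ⟨A, hA, hS, rfl⟩ := mem_link.1 hB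
  rwa [union_sdiff_of_subset hS]

/-- `A ↦ A ∖ S` is injective on sets containing `S`. [folklore] -/
private theorem sdiff_injOn (S : Finset α) {A A' : Finset α} (hA : S ⊆ A) (hA' : S ⊆ A')
    (h : A \ S = A' \ S) : A = A' := by
  rw [← union_sdiff_of_subset hA, ← union_sdiff_of_subset hA', h]

/-- `|ℱ(S)|` (as a link) `= |{A ∈ ℱ : S ⊆ A}|`. [cite: KupavskiiZakharov2022, §2 (p. 6, definition of ℱ(S))] -/
theorem card_link (ℱ : Finset (Finset α)) (S : Finset α) : #(link ℱ S) = #(supersets ℱ S) :=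
  card_image_of_injOn fun _ hA _ hA' h =>
    sdiff_injOn S (mem_supersets.1 (mem_coe.1 hA)).2 (mem_supersets.1 (mem_coe.1 hA')).2 h

/-- The link is monotone in the family. [cite: KupavskiiZakharov2022, §2 (p. 6, definition of ℱ(S))] -/
theorem link_mono (h : ℱ ⊆ 𝒜) (S : Finset α) : link ℱ S ⊆ link 𝒜 S :=
  image_subset_image (supersets_mono h S)

/-- If every member of `ℱ` contains `S` then `{A ∈ ℱ : S ⊆ A} = ℱ`. [cite: KupavskiiZakharov2022, §2 (p. 6)] -/
theorem supersets_eq_self_of_forall (hℱ : ∀ A ∈ ℱ, S ⊆ A) : supersets ℱ S = ℱ :=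
  filter_true_of_mem hℱ

/-- **Stars in the link**: for `T` disjoint from `S`, `ℱ(S)(T)` (members of the link containing `T`)
is the link at `S` of `{A ∈ ℱ : S ∪ T ⊆ A}`. [cite: KupavskiiZakharov2022, §2 (p. 6) and §3.1 (𝒜(S)(S') = 𝒜(S ∪ S'))] -/
theorem supersets_link_of_disjoint (hT : Disjoint S T) :
    supersets (link ℱ S) T = link (supersets ℱ (S ∪ T)) S := by
  ext B
  simp only [mem_supersets, mem_link, union_subset_iff]
  constructor
  · rintro ⟨⟨A, hA, hS, rfl⟩, hTB⟩
    exact ⟨A, ⟨hA, hS, hTB.trans sdiff_subset⟩, hS, rfl⟩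
  · rintro ⟨A, ⟨hA, hS, hTA⟩, -, rfl⟩
    refine ⟨⟨A, hA, hS, rfl⟩, fun x hx => mem_sdiff.2 ⟨hTA hx, fun hxS => ?_⟩⟩
    exact disjoint_left.1 hT hxS hx

/-- Cardinality of stars in the link: `|ℱ(S)(T)| = |{A ∈ ℱ : S ∪ T ⊆ A}|` for `T` disjoint from `S`.
[cite: KupavskiiZakharov2022, §3.1 (𝒜(S)(S') = 𝒜(S ∪ S'))] -/
theorem card_supersets_link_of_disjoint (hT : Disjoint S T) :
    #(supersets (link ℱ S) T) = #(supersets ℱ (S ∪ T)) := by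
  rw [supersets_link_of_disjoint hT, card_link]
  congr 1
  exact filter_true_of_mem fun A hA => subset_union_left.trans (mem_supersets.1 hA).2

/-- A set meeting `S` is contained in no member of the link. [cite: KupavskiiZakharov2022, §2 (p. 6, definition of ℱ(S))] -/
theorem supersets_link_of_not_disjoint (hT : ¬ Disjoint S T) : supersets (link ℱ S) T = ∅ :=
  filter_eq_empty_iff.2 fun _ hB hTB => hT ((disjoint_of_mem_link hB).mono_right hTB)

/-- **KZ Lemma 11 (ii), LINK FORM.** If every member of `ℱ` contains `S` and `ℱ` is
`(𝒜(S), τ)`-homogeneous (members kept whole, as in `SpreadApproximation.homogeneous`), then the link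
`ℱ(S)` is `(𝒜(S), τ)`-homogeneous as families on the ground set with `S` removed — the printed form
"`ℱ_B(B)` is `(𝒜(B), τ)`-homogeneous". (`τ ≥ 0`; test sets meeting `S` contribute `0 ≤ 0`.)
[cite: KupavskiiZakharov2022, Lemma 11 (ii)] -/
theorem IsRelHomogeneous.link {τ : ℝ} (hτ : 0 ≤ τ) (hℱ : ∀ A ∈ ℱ, S ⊆ A)
    (h : IsRelHomogeneous τ (supersets 𝒜 S) ℱ) :
    IsRelHomogeneous τ (link 𝒜 S) (link ℱ S) := by
  intro T
  by_cases hT : Disjoint S T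
  · have key := h T
    rw [supersets_supersets] at key
    have hST : supersets ℱ (S ∪ T) = supersets ℱ T := by
      ext A
      simp only [mem_supersets, union_subset_iff]
      exact ⟨fun h' => ⟨h'.1, h'.2.2⟩, fun h' => ⟨h'.1, hℱ A h'.1, h'.2⟩⟩
    rw [card_supersets_link_of_disjoint hT, card_supersets_link_of_disjoint hT, card_link, card_link,
      supersets_eq_self_of_forall hℱ, hST]
    exact key
  · rw [supersets_link_of_not_disjoint hT, card_empty, Nat.cast_zero, zero_mul]
    positivity

/-- The pieces of a spread approximation in link form: `ℱ_i(S_i)` is `(𝒜(S_i), τ)`-homogeneous as a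
family on the ground set minus `S_i` (`τ ≥ 0`). [cite: KupavskiiZakharov2022, Lemma 11 (ii)] -/
theorem SpreadApproximation.link_homogeneous {τ : ℝ} {q : ℕ} (D : SpreadApproximation 𝒜 ℱ τ q)
    (hτ : 0 ≤ τ) (i : Fin D.k) :
    IsRelHomogeneous τ (link 𝒜 (D.core i)) (link (D.piece i) (D.core i)) :=
  (D.homogeneous i).link hτ (subset_of_mem_of_subset_supersets (D.piece_subset i))

/-- `|ℱ_i(S_i)| = |ℱ_i|` (every member of the piece contains the core). [cite: KupavskiiZakharov2022, Lemma 11 (ii)] -/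
theorem SpreadApproximation.card_link_piece {τ : ℝ} {q : ℕ} (D : SpreadApproximation 𝒜 ℱ τ q)
    (i : Fin D.k) : #(link (D.piece i) (D.core i)) = #(D.piece i) := by
  rw [card_link, supersets_eq_self_of_forall (subset_of_mem_of_subset_supersets (D.piece_subset i))]

/-- `ℱ_i(S_i) ⊆ 𝒜(S_i)` as links, for `ℱ ⊆ 𝒜`. [cite: KupavskiiZakharov2022, Lemma 11 (ii)] -/
theorem SpreadApproximation.link_piece_subset {τ : ℝ} {q : ℕ} (D : SpreadApproximation 𝒜 ℱ τ q)
    (hℱ : ℱ ⊆ 𝒜) (i : Fin D.k) : link (D.piece i) (D.core i) ⊆ link 𝒜 (D.core i) :=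
  link_mono (D.piece_subset_family i |>.trans hℱ) _

omit [DecidableEq α] in
/-- `Finset.image g` is injective on the subsets of a set on which `g` is injective. [folklore] -/
private theorem image_injOn_of_subset {β : Type*} [DecidableEq β] {g : α → β} {E : Finset α}
    (hg : Set.InjOn g E) {A A' : Finset α} (hA : A ⊆ E) (hA' : A' ⊆ E)
    (h : A.image g = A'.image g) : A = A' := by
  have key : ∀ {B B' : Finset α}, B ⊆ E → B' ⊆ E → B.image g = B'.image g → B ⊆ B' := by
    intro B B' hB hB' hBB' x hx
    have : g x ∈ B'.image g := hBB' ▸ mem_image_of_mem g hx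
    obtain ⟨x', hx', hxx'⟩ := mem_image.1 this
    rwa [hg (hB hx) (hB' hx') hxx'.symm]
  exact Subset.antisymm (key hA hA' h) (key hA' hA h.symm)

/-- **Relative homogeneity is invariant under relabelling the ground set**: if `g` is injective on a
set `E` containing every member of `𝒜` and of `ℱ`, then `ℱ` is `(𝒜, τ)`-homogeneous iff... (here: ⇒)
the relabelled family `{g(A) : A ∈ ℱ}` is `({g(A) : A ∈ 𝒜}, τ)`-homogeneous (`τ ≥ 0`; a test set not
inside `g(E)` is contained in no relabelled member). Used to move a reduced instance to a standard
ground set. [cite: KupavskiiZakharov2022, §2 (definition of (𝒜, τ)-homogeneous; invariant under renaming the ground set)] -/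
theorem IsRelHomogeneous.image_image {β : Type*} [DecidableEq β] {τ : ℝ} (hτ : 0 ≤ τ)
    {E : Finset α} {g : α → β} (hg : Set.InjOn g E) (h𝒜 : ∀ A ∈ 𝒜, A ⊆ E) (hℱ : ∀ A ∈ ℱ, A ⊆ E)
    (h : IsRelHomogeneous τ 𝒜 ℱ) :
    IsRelHomogeneous τ (𝒜.image (Finset.image g)) (ℱ.image (Finset.image g)) := by
  intro T
  have hcard : ∀ 𝒳 : Finset (Finset α), (∀ A ∈ 𝒳, A ⊆ E) → #(𝒳.image (Finset.image g)) = #𝒳 :=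
    fun 𝒳 h𝒳 => card_image_of_injOn fun A hA A' hA' hAA' =>
      image_injOn_of_subset hg (h𝒳 A (mem_coe.1 hA)) (h𝒳 A' (mem_coe.1 hA')) hAA'
  by_cases hT : T ⊆ E.image g
  · -- `T = g(T₀)` with `T₀ ⊆ E`
    set T₀ : Finset α := E.filter (fun x => g x ∈ T) with hT₀
    have hT₀E : T₀ ⊆ E := filter_subset _ _
    have hTT₀ : T₀.image g = T := by
      ext y
      simp only [hT₀, mem_image, mem_filter]
      constructor
      · rintro ⟨x, ⟨-, hx⟩, rfl⟩; exact hx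
      · intro hy
        obtain ⟨x, hxE, rfl⟩ := mem_image.1 (hT hy)
        exact ⟨x, ⟨hxE, hy⟩, rfl⟩
    have hcardT : #T = #T₀ := by rw [← hTT₀, card_image_of_injOn (hg.mono (coe_subset.2 hT₀E))]
    have hsup : ∀ 𝒳 : Finset (Finset α), (∀ A ∈ 𝒳, A ⊆ E) →
        supersets (𝒳.image (Finset.image g)) T = (supersets 𝒳 T₀).image (Finset.image g) := by
      intro 𝒳 h𝒳
      ext B
      simp only [mem_supersets, mem_image]
      constructor
      · rintro ⟨⟨A, hA, rfl⟩, hTB⟩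
        refine ⟨A, ⟨hA, fun x hx => ?_⟩, rfl⟩
        obtain ⟨hxE, hgx⟩ := mem_filter.1 hx
        obtain ⟨a, ha, hga⟩ := mem_image.1 (hTB hgx)
        rwa [hg hxE (h𝒳 A hA ha) hga.symm]
      · rintro ⟨A, ⟨hA, hT₀A⟩, rfl⟩
        exact ⟨⟨A, hA, rfl⟩, by rw [← hTT₀]; exact image_subset_image hT₀A⟩
    rw [hsup ℱ hℱ, hsup 𝒜 h𝒜, hcard _ (fun A hA => hℱ A (supersets_subset _ _ hA)),
      hcard _ (fun A hA => h𝒜 A (supersets_subset _ _ hA)), hcard 𝒜 h𝒜, hcard ℱ hℱ, hcardT]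
    exact h T₀
  · have hempty : supersets (ℱ.image (Finset.image g)) T = ∅ := by
      refine filter_eq_empty_iff.2 fun B hB hTB => hT ?_
      obtain ⟨A, hA, rfl⟩ := mem_image.1 hB
      exact hTB.trans (image_subset_image (hℱ A hA))
    rw [hempty, card_empty, Nat.cast_zero, zero_mul]
    positivity

end Links

end Literature.Combinatorics.SetFamily
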